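import Summits.QuantumFields.YangMills.Theorems.BalabanUVNodesSpineRates

/-!
# BalabanUVNodes ∕ node N18 = NE5 — TRANSPORT OF RECORD + COHERENCE PRICE (LENS card T1): `NE5` and `N18At` (hence `S_N18` at any
# rate-record home) are INSENSITIVE to WHICH identification `transport : BgB → BgA` of run B's backgrounds with run A's the objects of record carry,
# at the booked price `C₅ + D` — `D·θ^k` = run A's background-Lipschitz modulus × the gauge distance of the two transports

Cell `pub-ymgap`, HUMAN RULING D-0062 (Track A), R134 seat `pub-ymgap-dag-n18-d` (strategy s2: by-name knit at the ₁₁ record), generation 0, module 6.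
THEOREMS ONLY (0 `def`, 0 `sorry`, standard axioms), STAGE-FREE (no Stage-11 ∕ Stage-12 key is read: after node00-def-T's LOCATED-2, pub-ymgap INBOX l.12862 —
`Stage11Params.Provisos₁₁` uninhabited, the ₁₁ home located-vacuous, content re-keyed to ₁₂ — the at-home corollary is deferred to this seat's ₁₂ module and
follows there from §2 + the ₁₂ twin of module 5's `s_N18_rRec₁₁_of_ofFixed_mono` in one line); imports `BalabanUVNodesSpineRates` only (`U3Carriers`, `N18At`);
modifies nothing; `--supports stmt-QuantumFields-19676` (K3 `SpineGivenEndpointR11`, re-keyed per dag-lead's old→new map at rev 8).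

SOURCE OF THE MECHANISM.  The LENS-TRANSFER memo of seat `ym-lens-BalabanUVNodes-transfer` g0 (pub-ymgap INBOX l.12581, 2026-08-26T16:20Z; card T1
«TRANSPORT COHERENCE», addressed to def-W1 ∕ n18-d; dag-lead FAN-OUT §4 «§N18 s4: transport of record + coherence price»): §1's two lemmas are ADAPTED from
its never-landed sketch `run/shared/lean/pub/pub-ymgap/ym-lens-BalabanUVNodes-transfer/lean/LensTransferSketch.lean` §1 (`YMLens.Transfer.ne5_of_transport_swap`,
`backgroundsClose_of_transport_swap`; farm rc 0 there), with the sketch's two `def`s (`withTransport`, `TransportCoherence`) INLINED as the structure-update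
literal `{ C with transport := T' }` and a displayed hypothesis, so that this file declares no definition.

WHY (the located issue, LENS §5 (iii) «transport identity is load-bearing for equalities»).  `T4OutputRate.Carriers.transport : BgB → BgA` — the
identification of a run-B background with a run-A background through which NE5 compares `E_A(g, transport U, X)` with `E_B(b∷g, U, X)` — is UNPRINTED pairing
data.  Candidates of record differ: the H-layer END of module 1 §3 reads the DATUM's block averaging `transportRaw F K (blockAvg expMeanLogSU)`
(`datumCarriers_transport_of_isRecordOfRecord₁₁C`); definer W1 leaves `RunPairing.transport` a PARAMETER «supplied by the N18 side»; rungs ∕ NE3's driven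
pairs may use minimizer-level or gauge-fixed-representative identifications.  They agree only up to geometric-rate gauge distances ([B8] Prop. 3:
`O(η′²L²‖∂U‖)`; [B10] minimizer dependence; King 1986 Lemma 4.2: `L^{−k∕2}`).  THIS FILE books the choice: NE5 through ANY transport `T′` plus run A's
background-Lipschitz bracket `LipBackground EA W κ CU` ([III] (2.27)(ii), a displayed hypothesis of `T4OutputRate`) plus the COHERENCE LETTER
`CU g k · gauge(transport U, T′ U) ≤ D·θ^k` (displayed; its instances are printed-kind facts cited when typed, literature lane) give NE5 through the objects'
own transport with constant `C₅ + D` — one triangle inequality.  So the knit at the rate-record home (module 5 at ₁₁, its ₁₂ twin next) does not depend on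
which transport the definer picks, and the rate `θ_tr` of the chosen identification is BOOKED into NE5's `θ` (harmless for U3, which needs `θ < 1` only, but visible).
* §1 `ne5_of_transport_swap` (NE5 through `T′` + `LipBackground` + coherence ⇒ NE5 through `C.transport`, constant `C₅ + D`), `ne5_to_transport_swap` (the
  converse orientation, by structure eta), `backgroundsClose_of_transport_swap` (node U3's `BackgroundsClose` letter likewise, gauge triangle inequality
  displayed — `Carriers` does not carry it).
* §2 `n18At_of_transport_swap` — the same for `N18At` (every member `b` of run B's family; the Lipschitz bracket is run A's, member-free), and
  `n18At_to_transport_swap` (converse orientation).  AT A RATE-RECORD HOME whose reading's U3 objects are `ofFixed v.C v.EA v.EB ℓ` for a bundle `v` whose NE5 is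
  known THROUGH ANOTHER TRANSPORT `T′` (an END's — e.g. the datum's block averaging while the definer's objects carry `RunPairing.transport`), §2 + the home's
  `…_of_ofFixed_mono` face give `S_N18` there with the record's letters dominating `(v.κ, v.θ, v.C₅ + D)` — one line, typed in the ₁₂ home module.
* §1 also `coherence_zero_of_transport_eq` — kill-test (a) of the card in the kernel: if the two transports COINCIDE on run B's backgrounds and the gauge
  vanishes on the diagonal (displayed), the coherence letter holds with price `D = 0` whatever the Lipschitz modulus — the swap degenerates to a remark.

HONEST FRAMING.  Kernel bookkeeping (triangle inequalities); count-neutral; restates nothing; no Theses import.  NOT an estimate of Bałaban's; NOT a proof that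
two identifications are close (those are [B8] Prop. 3 ∕ [B10] ∕ King Lemma 4.2-type printed facts, to be cited BY NAME when typed); not a change to
`T4OutputRate.Carriers` or to any node statement; not a claim that any seat's transport is wrong.  NE5 NOT IN PRINT ∕ NOT proved; N18 NOT discharged; K0 open;
one finite four-torus programme at fixed `ε`; NOT infinite volume, NOT OS on ℝ⁴, NOT a mass gap, NOT Clay.
-/

noncomputable section

namespace YMDAG.N18.TransportSwap

open Literature.MathematicalPhysics.QuantumFieldTheory.Balaban1983to89
open Literature.MathematicalPhysics.QuantumFieldTheory.Balaban1983to89.T4Continuum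
open Literature.MathematicalPhysics.QuantumFieldTheory.Balaban1983to89.T4OutputRate (Carriers Functional NE5 LipBackground BackgroundsClose Window)
open YMDAG.UVSplit

/-! ## §1 NE5 and `BackgroundsClose` under a swap of the transport of record -/

section Swap

-- adapted from run/shared/lean/pub/pub-ymgap/ym-lens-BalabanUVNodes-transfer/lean/LensTransferSketch.lean §1 (seat ym-lens-transfer g0; never landed there)
variable {C : Carriers}

/-- **NE5 THROUGH ANY TRANSPORT `T′` + RUN A's BACKGROUND-LIPSCHITZ BRACKET + THE COHERENCE LETTER ⇒ NE5 THROUGH THE TRANSPORT OF RECORD, CONSTANT `C₅ + D`**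
[bookkeeping; LENS card T1].  The carriers with the transport replaced are the structure-update literal `{ C with transport := T' }` (domains, scales, tree
lengths, background types, gauge unchanged — so `EA`, `EB` ARE functionals on it definitionally); the coherence letter is «in run A's gauge the record's
transport `C.transport U` and `T′ U` of the same run-B background are `θ^k`-close once weighted by the Lipschitz modulus `CU g k`».  One triangle inequality.
[cite: Balaban1988Convergent, (2.27)(ii) p.259; Balaban1987RG1, Thm 1 p.259] -/
theorem ne5_of_transport_swap {EA : Functional C C.BgA} {EB : Functional C C.BgB} {W : Set (ℕ → ℝ)} {κ θ C₅ D : ℝ}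
    {CU : (ℕ → ℝ) → ℕ → ℝ} (T' : C.BgB → C.BgA)
    (h5 : NE5 (C := { C with transport := T' }) EA EB W κ θ C₅) (hU : LipBackground EA W κ CU)
    (hT : ∀ g ∈ W, ∀ (U : C.BgB) (k : ℕ), CU g k * C.gauge (C.transport U) (T' U) ≤ D * θ ^ k) :
    NE5 EA EB W κ θ (C₅ + D) := by
  intro g hg U X
  have h1 := hU g hg (C.transport U) (T' U) X
  have h2 : |EA g (T' U) X - EB g U X| ≤ C₅ * θ ^ C.scale X * Real.exp (-(κ * C.d X)) := h5 g hg U X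
  have h3 := hT g hg U (C.scale X)
  have he : 0 ≤ Real.exp (-(κ * C.d X)) := (Real.exp_pos _).le
  calc |EA g (C.transport U) X - EB g U X|
      ≤ |EA g (C.transport U) X - EA g (T' U) X| + |EA g (T' U) X - EB g U X| := abs_sub_le _ _ _
    _ ≤ CU g (C.scale X) * Real.exp (-(κ * C.d X)) * C.gauge (C.transport U) (T' U)
        + C₅ * θ ^ C.scale X * Real.exp (-(κ * C.d X)) := add_le_add h1 h2
    _ ≤ D * θ ^ C.scale X * Real.exp (-(κ * C.d X)) + C₅ * θ ^ C.scale X * Real.exp (-(κ * C.d X)) := by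
        have h4 : CU g (C.scale X) * Real.exp (-(κ * C.d X)) * C.gauge (C.transport U) (T' U)
            ≤ D * θ ^ C.scale X * Real.exp (-(κ * C.d X)) := by
          rw [mul_right_comm]
          exact mul_le_mul_of_nonneg_right h3 he
        linarith
    _ = (C₅ + D) * θ ^ C.scale X * Real.exp (-(κ * C.d X)) := by ring

/-- **THE CONVERSE ORIENTATION** [bookkeeping]: NE5 through the transport of record + run A's Lipschitz bracket + the coherence letter read the other way
(`CU g k · gauge(T′ U, C.transport U) ≤ D·θ^k` — `Carriers.gauge` is not assumed symmetric) ⇒ NE5 through `T′`, constant `C₅ + D` — `ne5_of_transport_swap` at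
the swapped carriers, by structure eta (`{ { C with transport := T' } with transport := C.transport }` IS `C`). [cite: Balaban1988Convergent, (2.27)(ii) p.259] -/
theorem ne5_to_transport_swap {EA : Functional C C.BgA} {EB : Functional C C.BgB} {W : Set (ℕ → ℝ)} {κ θ C₅ D : ℝ}
    {CU : (ℕ → ℝ) → ℕ → ℝ} (T' : C.BgB → C.BgA)
    (h5 : NE5 EA EB W κ θ C₅) (hU : LipBackground EA W κ CU)
    (hT : ∀ g ∈ W, ∀ (U : C.BgB) (k : ℕ), CU g k * C.gauge (T' U) (C.transport U) ≤ D * θ ^ k) :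
    NE5 (C := { C with transport := T' }) EA EB W κ θ (C₅ + D) :=
  ne5_of_transport_swap (C := { C with transport := T' }) C.transport h5 hU hT

/-- **NODE U3's `BackgroundsClose` LETTER UNDER THE SWAP** [bookkeeping; LENS card T1]: closeness of the driven run-A background to `T′` of the driven run-B
background, plus coherence of the two transports at the driven backgrounds, give closeness to the transport of record — the triangle inequality for `gauge`
DISPLAYED as a hypothesis (`Carriers` does not carry it; the `Node00` gauge of record is a sup-norm difference, for which it holds).
[cite: Balaban1987RG1, (0.21)–(0.22) p.256] -/
theorem backgroundsClose_of_transport_swap {V : Type} {uA : V → C.BgA} {uB : V → C.BgB} {δ δ' : ℝ} (T' : C.BgB → C.BgA)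
    (htri : ∀ U₁ U₂ U₃ : C.BgA, C.gauge U₁ U₃ ≤ C.gauge U₁ U₂ + C.gauge U₂ U₃)
    (hclose : BackgroundsClose (C := { C with transport := T' }) uA uB δ)
    (hcoh : ∀ v, C.gauge (T' (uB v)) (C.transport (uB v)) ≤ δ') :
    BackgroundsClose uA uB (δ + δ') :=
  fun v => (htri _ _ _).trans (add_le_add (hclose v) (hcoh v))

/-- **KILL-TEST (a) OF THE CARD, IN THE KERNEL** [bookkeeping]: if the alternative transport COINCIDES with the record's on run B's backgrounds and the gauge
vanishes on the diagonal, the coherence letter holds with price `D = 0` for any Lipschitz modulus and any rate — the swap degenerates to a remark.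
[folklore] -/
theorem coherence_zero_of_transport_eq {W : Set (ℕ → ℝ)} {θ : ℝ} {CU : (ℕ → ℝ) → ℕ → ℝ} (T' : C.BgB → C.BgA)
    (heq : ∀ U : C.BgB, T' U = C.transport U) (hdiag : ∀ U : C.BgA, C.gauge U U = 0) :
    ∀ g ∈ W, ∀ (U : C.BgB) (k : ℕ), CU g k * C.gauge (C.transport U) (T' U) ≤ 0 * θ ^ k := by
  intro g _ U k
  rw [heq U, hdiag, mul_zero, zero_mul]

end Swap

/-! ## §2 `N18At` under a swap of the transport of record -/

/-- **`N18At` IS INSENSITIVE TO THE TRANSPORT OF RECORD AT THE BOOKED PRICE** [bookkeeping]: N18 at a U3 bundle whose carriers read run B's backgrounds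
through `T′`, plus run A's Lipschitz bracket on the bundle's window and the coherence letter at price `D`, give N18 at the same bundle through the carriers'
own transport with constant `C₅ + D` — §1 at every member `b ∈ ]0, γ]` of run B's family (the bracket is run A's, member-free).
[cite: Balaban1987RG1, Thm 1 p.259; Balaban1988Convergent, (2.27)(ii) p.259] -/
theorem n18At_of_transport_swap {C : Carriers} {W : Set (ℕ → ℝ)} {γ κ θ C₅ D : ℝ} {EA : Functional C C.BgA}
    {EB : ℝ → Functional C C.BgB} {CU : (ℕ → ℝ) → ℕ → ℝ} {Λ : ℕ → ℕ → ℝ} {C₉ ωm cr ρ : ℝ} (T' : C.BgB → C.BgA)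
    (h : N18At ⟨{ C with transport := T' }, W, γ, κ, EA, EB, θ, C₅, Λ, C₉, ωm, cr, ρ⟩) (hU : LipBackground EA W κ CU)
    (hT : ∀ g ∈ W, ∀ (U : C.BgB) (k : ℕ), CU g k * C.gauge (C.transport U) (T' U) ≤ D * θ ^ k) :
    N18At ⟨C, W, γ, κ, EA, EB, θ, C₅ + D, Λ, C₉, ωm, cr, ρ⟩ :=
  fun b hb hbγ => ne5_of_transport_swap T' (h b hb hbγ) hU hT

/-- **THE CONVERSE ORIENTATION FOR `N18At`** [bookkeeping]: N18 through the carriers' own transport + run A's Lipschitz bracket + the coherence letter read the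
other way ⇒ N18 through `T′`, constant `C₅ + D` (structure eta, as `ne5_to_transport_swap`). [cite: Balaban1987RG1, Thm 1 p.259; Balaban1988Convergent, (2.27)(ii) p.259] -/
theorem n18At_to_transport_swap {C : Carriers} {W : Set (ℕ → ℝ)} {γ κ θ C₅ D : ℝ} {EA : Functional C C.BgA}
    {EB : ℝ → Functional C C.BgB} {CU : (ℕ → ℝ) → ℕ → ℝ} {Λ : ℕ → ℕ → ℝ} {C₉ ωm cr ρ : ℝ} (T' : C.BgB → C.BgA)
    (h : N18At ⟨C, W, γ, κ, EA, EB, θ, C₅, Λ, C₉, ωm, cr, ρ⟩) (hU : LipBackground EA W κ CU)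
    (hT : ∀ g ∈ W, ∀ (U : C.BgB) (k : ℕ), CU g k * C.gauge (T' U) (C.transport U) ≤ D * θ ^ k) :
    N18At ⟨{ C with transport := T' }, W, γ, κ, EA, EB, θ, C₅ + D, Λ, C₉, ωm, cr, ρ⟩ :=
  fun b hb hbγ => ne5_to_transport_swap T' (h b hb hbγ) hU hT

end YMDAG.N18.TransportSwap

end
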